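import Mathlib
import Literature.Combinatorics.Optimization.RandomPairMultigraphSparsity
import Literature.Combinatorics.Optimization.SparsePathDecomposable
import Literature.Combinatorics.Optimization.SheraliAdamsLocalDistributions
import Literature.Combinatorics.Expanders.SlotGraphCuts
import HarnessLib

/-!
# Random sparse multigraphs, III: the pruned edge set (deterministic part of the alterations)

[topic Combinatorics/Optimization]

Third file toward `CharikarMakarychevMakarychev2009_gapGraphs`.  For an outcome
`ω : Fin M → Fin n × Fin n` of the random pair multigraph we DELETE ("modulo a few small
alterations", [AroraBollobasLovaszTourlakis2006] Lemma 2.8 proof, p. 26–27: "Deleting an edge from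
each of these cycles then gives a graph of girth at least `g`"; for the degrees cf.
[CharikarMakarychevMakarychev2009] p. 11 "maximum degree `∆`") the indices carrying a loop, touching
a vertex of degree `≥ D`, or lying on a closed tuple of length `≤ g`, and take the set of unordered
pairs carried by the kept indices: `pruned D g ω : Finset (Sym2 (Fin n))`.  This file proves the
deterministic facts about it:

* `pruned_loopless`, `edeg_pruned_lt` (every vertex lies on `< D` edges — for EVERY `ω`);
* `sum_cutFn_pruned_le` (a cut of the pruned graph cuts at most `cutCount` sampled pairs),
  `card_filter_subset_le_inCount` (edges inside `W` ≤ sampled pairs inside `W × W`),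
  `le_card_pruned_add` (`M ≤ |pruned| + loops + high incidences + |cycIdx| + repeated pairs`);
* `girth_pruned` (every cycle of `gr (pruned D g ω)` has length `> g`: a cycle of length `j ≤ g`
  would be a closed tuple of kept indices).

Everything is proved; no named facts.

## References

* [AroraBollobasLovaszTourlakis2006] Theory of Computing 2 (2006), Lemma 2.8 proof (p. 26–27).
* [CharikarMakarychevMakarychev2009] STOC 2009, §5 p. 10–11.
-/

noncomputable section

open Finset SimpleGraph

namespace Literature.Combinatorics.Optimization

namespace RandomPairs

variable {n M : ℕ}

/-- The unordered pair carried by index `i`. [cite: AroraBollobasLovaszTourlakis2006, Lemma 2.8 proof (p. 26)] -/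
def pairOf (ω : Fin M → Fin n × Fin n) (i : Fin M) : Sym2 (Fin n) := s((ω i).1, (ω i).2)

/-- The indices touching a vertex of degree `≥ D`. [cite: CharikarMakarychevMakarychev2009, §5 (p. 11: "maximum degree ∆")] -/
def highIdx (D : ℕ) (ω : Fin M → Fin n × Fin n) : Finset (Fin M) :=
  (univ : Finset (Fin M)).filter fun i => D ≤ deg (ω i).1 ω ∨ D ≤ deg (ω i).2 ω

/-- The kept indices: no loop, no high-degree endpoint, on no closed tuple of length `≤ g`.
[cite: AroraBollobasLovaszTourlakis2006, Lemma 2.8 proof (p. 26–27: alterations)] -/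
def keep (D g : ℕ) (ω : Fin M → Fin n × Fin n) : Finset (Fin M) :=
  (univ : Finset (Fin M)).filter fun i =>
    (ω i).1 ≠ (ω i).2 ∧ i ∉ highIdx D ω ∧ i ∉ cycIdx g ω

/-- **The pruned edge set** of the outcome `ω`. [cite: AroraBollobasLovaszTourlakis2006, Lemma 2.8 proof (p. 26–27)] -/
def pruned (D g : ℕ) (ω : Fin M → Fin n × Fin n) : Finset (Sym2 (Fin n)) :=
  (keep D g ω).image (pairOf ω)

/-- Membership in the pruned edge set. [cite: AroraBollobasLovaszTourlakis2006, Lemma 2.8 proof (p. 26)] -/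
theorem mem_pruned {D g : ℕ} {ω : Fin M → Fin n × Fin n} {e : Sym2 (Fin n)} :
    e ∈ pruned D g ω ↔ ∃ i ∈ keep D g ω, pairOf ω i = e := by
  simp [pruned, mem_image]

/-- The pruned edge set is loopless. [cite: AroraBollobasLovaszTourlakis2006, Lemma 2.8 proof (p. 26)] -/
theorem pruned_loopless (D g : ℕ) (ω : Fin M → Fin n × Fin n) : ∀ e ∈ pruned D g ω, ¬ e.IsDiag := by
  intro e he
  obtain ⟨i, hi, rfl⟩ := mem_pruned.1 he
  have := (mem_filter.1 hi).2.1
  simpa [pairOf] using this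

/-- The number of pruned edges satisfying a property is at most the number of kept indices whose
pair satisfies it. [cite: AroraBollobasLovaszTourlakis2006, Lemma 2.8 proof (p. 26)] -/
theorem card_filter_pruned_le (D g : ℕ) (ω : Fin M → Fin n × Fin n) (P : Sym2 (Fin n) → Prop)
    [DecidablePred P] :
    ((pruned D g ω).filter P).card ≤ ((keep D g ω).filter fun i => P (pairOf ω i)).card := by
  classical
  have : (pruned D g ω).filter P = ((keep D g ω).filter fun i => P (pairOf ω i)).image (pairOf ω) := by
    ext e
    simp only [pruned, mem_filter, mem_image]
    constructor
    · rintro ⟨⟨i, hi, rfl⟩, hP⟩; exact ⟨i, ⟨hi, hP⟩, rfl⟩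
    · rintro ⟨i, ⟨hi, hP⟩, rfl⟩; exact ⟨⟨i, hi, rfl⟩, hP⟩
  rw [this]
  exact card_image_le

/-- **Bounded degree, deterministically**: every vertex lies on `< D` pruned edges (`D ≥ 1`).
[cite: CharikarMakarychevMakarychev2009, §5 (p. 11: "maximum degree ∆")] -/
theorem edeg_pruned_lt {D : ℕ} (hD : 1 ≤ D) (g : ℕ) (ω : Fin M → Fin n × Fin n) (v : Fin n) :
    ((pruned D g ω).filter fun e => v ∈ e).card < D := by
  classical
  refine lt_of_le_of_lt (card_filter_pruned_le D g ω (fun e => v ∈ e)) ?_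
  by_cases hne : ((keep D g ω).filter fun i => v ∈ pairOf ω i).Nonempty
  · obtain ⟨i, hi⟩ := hne
    obtain ⟨hik, hvi⟩ := mem_filter.1 hi
    have hnot : i ∉ highIdx D ω := (mem_filter.1 hik).2.2.1
    have hdeg : deg v ω < D := by
      by_contra h
      push Not at h
      refine hnot (mem_filter.2 ⟨mem_univ _, ?_⟩)
      simp only [pairOf, Sym2.mem_iff] at hvi
      rcases hvi with rfl | rfl
      · exact Or.inl h
      · exact Or.inr h
    refine lt_of_le_of_lt ?_ hdeg
    refine card_le_card fun j hj => mem_filter.2 ⟨mem_univ _, mem_filter.2 ⟨mem_univ _, ?_⟩⟩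
    have := (mem_filter.1 hj).2
    simp only [pairOf, Sym2.mem_iff] at this
    rcases this with h | h
    · exact Or.inl h.symm
    · exact Or.inr h.symm
  · rw [not_nonempty_iff_eq_empty.1 hne, card_empty]; omega

/-- **Cuts of the pruned graph cut at most `cutCount` sampled pairs.**
[cite: CharikarMakarychevMakarychev2009, §5 (p. 10)] -/
theorem sum_cutFn_pruned_le (D g : ℕ) (ω : Fin M → Fin n × Fin n) (x : Fin n → Bool) :
    ∑ e ∈ pruned D g ω, cutFn e x ≤ (cutCount x ω : ℝ) := by
  classical
  have h1 : ∑ e ∈ pruned D g ω, cutFn e x = (((pruned D g ω).filter fun e => IsCutBy x e = true).card : ℝ) := by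
    rw [Finset.card_filter]; push_cast
    refine Finset.sum_congr rfl fun e _ => ?_
    unfold cutFn; split_ifs <;> simp_all
  rw [h1]
  have h2 := card_filter_pruned_le D g ω (fun e => IsCutBy x e = true)
  have h3 : ((keep D g ω).filter fun i => IsCutBy x (pairOf ω i) = true).card ≤ cutCount x ω := by
    refine card_le_card fun i hi => mem_filter.2 ⟨mem_univ _, ?_⟩
    have := (mem_filter.1 hi).2
    simpa [pairOf] using this
  exact_mod_cast h2.trans h3

/-- **Pruned edges inside `W` are at most the sampled pairs inside `W × W`.**
[cite: AroraBollobasLovaszTourlakis2006, Lemma 2.8 (p. 26: "every subgraph … contains at most (1+η)ℓ edges")] -/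
theorem card_filter_subset_le_inCount (D g : ℕ) (ω : Fin M → Fin n × Fin n) (W : Finset (Fin n)) :
    ((pruned D g ω).filter fun e => ∀ v ∈ e, v ∈ W).card ≤ inCount W ω := by
  classical
  refine (card_filter_pruned_le D g ω (fun e => ∀ v ∈ e, v ∈ W)).trans
    (card_le_card fun i hi => mem_filter.2 ⟨mem_univ _, ?_⟩)
  have h := (mem_filter.1 hi).2
  simp only [pairOf] at h
  exact mem_product.2 ⟨h _ (Sym2.mem_mk_left _ _), h _ (Sym2.mem_mk_right _ _)⟩

/-- `|highIdx| ≤ highInc`. [cite: CharikarMakarychevMakarychev2009, §5 (p. 11)] -/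
theorem card_highIdx_le (D : ℕ) (ω : Fin M → Fin n × Fin n) : (highIdx D ω).card ≤ highInc D ω := by
  classical
  have hsub : highIdx D ω ⊆ ((univ : Finset (Fin n)).filter fun v => D ≤ deg v ω).biUnion fun v =>
      univ.filter fun i => ω i ∈ incPairs v := by
    intro i hi
    rcases (mem_filter.1 hi).2 with h | h
    · exact mem_biUnion.2 ⟨(ω i).1, mem_filter.2 ⟨mem_univ _, h⟩,
        mem_filter.2 ⟨mem_univ _, mem_filter.2 ⟨mem_univ _, Or.inl rfl⟩⟩⟩
    · exact mem_biUnion.2 ⟨(ω i).2, mem_filter.2 ⟨mem_univ _, h⟩,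
        mem_filter.2 ⟨mem_univ _, mem_filter.2 ⟨mem_univ _, Or.inr rfl⟩⟩⟩
  refine (card_le_card hsub).trans (card_biUnion_le.trans ?_)
  unfold highInc
  rw [← Finset.sum_filter]
  exact le_rfl

/-- **Size of the pruned edge set**: `M ≤ |pruned| + loops + high incidences + |cycIdx| + repeats`.
[cite: AroraBollobasLovaszTourlakis2006, Lemma 2.8 proof (p. 26–27: "o(n) edges")] -/
theorem le_card_pruned_add (D g : ℕ) (ω : Fin M → Fin n × Fin n) :
    M ≤ (pruned D g ω).card + loopCount ω + highInc D ω + (cycIdx g ω).card + repCount ω := by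
  classical
  -- kept indices
  have hkeep : M ≤ (keep D g ω).card + loopCount ω + (highIdx D ω).card + (cycIdx g ω).card := by
    have hcover : (univ : Finset (Fin M)) ⊆ keep D g ω ∪ (univ.filter fun i => (ω i).1 = (ω i).2) ∪
        highIdx D ω ∪ cycIdx g ω := by
      intro i _
      by_cases h1 : (ω i).1 = (ω i).2
      · exact mem_union_left _ (mem_union_left _ (mem_union_right _ (mem_filter.2 ⟨mem_univ _, h1⟩)))
      by_cases h2 : i ∈ highIdx D ω
      · exact mem_union_left _ (mem_union_right _ h2)
      by_cases h3 : i ∈ cycIdx g ω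
      · exact mem_union_right _ h3
      · exact mem_union_left _ (mem_union_left _ (mem_union_left _ (mem_filter.2 ⟨mem_univ _, h1, h2, h3⟩)))
    have := card_le_card hcover
    rw [card_univ, Fintype.card_fin] at this
    refine this.trans ?_
    refine (card_union_le _ _).trans ?_
    refine Nat.add_le_add_right ((card_union_le _ _).trans (Nat.add_le_add_right ((card_union_le _ _).trans le_rfl) _)) _
  -- collisions
  have hcoll := Literature.Combinatorics.Expanders.card_le_card_image_add_card_collisions (keep D g ω) (pairOf ω)
  have hrep : ((keep D g ω ×ˢ keep D g ω).filter fun ab : Fin M × Fin M =>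
      ab.1 ≠ ab.2 ∧ pairOf ω ab.1 = pairOf ω ab.2).card ≤ repCount ω := by
    refine card_le_card fun ab hab => ?_
    obtain ⟨hab1, hne, heq⟩ := by simpa only [mem_filter, mem_product] using hab
    exact mem_filter.2 ⟨mem_offDiag.2 ⟨mem_univ _, mem_univ _, hne⟩, heq⟩
  have := card_highIdx_le D ω
  unfold pruned
  omega

/-! ### Girth: short cycles of the pruned graph are closed tuples of kept indices -/

/-- The successor-mod-`j` map on `Fin j`: either `t + 1`, or `0` at the last position. [folklore] -/
private theorem val_finRotate_cases {j : ℕ} (t : Fin j) :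
    (((finRotate j) t : Fin j) : ℕ) = t + 1 ∨ ((t : ℕ) + 1 = j ∧ (((finRotate j) t : Fin j) : ℕ) = 0) := by
  cases j with
  | zero => exact t.elim0
  | succ j' =>
    by_cases h : t = Fin.last j'
    · subst h
      right
      exact ⟨rfl, by simp⟩
    · left
      exact coe_finRotate_of_ne_last h


/-- **No short cycles survive**: every cycle of `gr (pruned D g ω)` has length `> g`.
[cite: AroraBollobasLovaszTourlakis2006, Lemma 2.8 proof (p. 27: "Deleting an edge from each of these cycles then gives a graph of girth at least g")] -/
theorem girth_pruned (D g : ℕ) (ω : Fin M → Fin n × Fin n) :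
    ∀ (u : Fin n) (c : (Multicut.gr (pruned D g ω)).Walk u u), c.IsCycle → g + 1 ≤ c.length := by
  classical
  intro u c hc
  by_contra hlen
  push Not at hlen
  set j := c.length with hj
  have hjg : j ≤ g := by omega
  -- the edges of the cycle and kept indices carrying them
  have hedge : ∀ t : Fin j, ∃ i ∈ keep D g ω, pairOf ω i = s(c.getVert t, c.getVert (t + 1)) := by
    intro t
    have hadj := c.adj_getVert_succ (i := t) (by omega)
    exact mem_pruned.1 (Multicut.gr_adj.1 hadj).1
  choose ι hιk hιe using hedge
  -- consecutive edges of a cycle are pairwise distinct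
  have hdist : ∀ t t' : Fin j, s(c.getVert t, c.getVert (t + 1)) = s(c.getVert t', c.getVert (t' + 1)) → t = t' := by
    intro t t' h
    have hnd := hc.edges_nodup
    have ht : (t : ℕ) < c.edges.length := by rw [Walk.length_edges]; exact t.2
    have ht' : (t' : ℕ) < c.edges.length := by rw [Walk.length_edges]; exact t'.2
    have he : ∀ (s : Fin j) (hs : (s : ℕ) < c.edges.length), c.edges[(s : ℕ)] = s(c.getVert s, c.getVert (s + 1)) := by
      intro s hs
      have hsd : (s : ℕ) < c.darts.length := by rw [Walk.length_darts]; exact s.2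
      simp only [Walk.edges, List.getElem_map, Walk.darts_getElem_eq_getVert _ hsd, Dart.edge_mk]
    have := (hnd.getElem_inj_iff (hi := ht) (hj := ht')).1 (by rw [he t ht, he t' ht', h])
    exact Fin.ext this
  have hιinj : Function.Injective ι := fun t t' h => hdist t t' (by rw [← hιe t, ← hιe t', h])
  -- the closed tuple
  have hjpos : 0 < j := by have := hc.three_le_length; omega
  have hcirc : (⟨⟨ι, hιinj⟩, fun t => c.getVert t⟩ : (Fin j ↪ Fin M) × (Fin j → Fin n)) ∈ circuits j ω := by
    refine mem_filter.2 ⟨mem_univ _, fun t => ?_⟩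
    change s((ω (ι t)).1, (ω (ι t)).2) = s(c.getVert t, c.getVert (finRotate j t))
    have h1 : s((ω (ι t)).1, (ω (ι t)).2) = s(c.getVert t, c.getVert (t + 1)) := hιe t
    rw [h1]
    congr 1
    -- `getVert (t+1) = getVert (finRotate t)`: equal unless `t` is last, where both are `u`
    rcases val_finRotate_cases t with h | ⟨hlast, h0⟩
    · rw [h]
    · rw [h0, hlast, hj, Walk.getVert_length, Walk.getVert_zero]
  exact (mem_filter.1 (hιk ⟨0, hjpos⟩)).2.2.2 (mem_cycIdx hjg hcirc ⟨0, hjpos⟩)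

end RandomPairs

end Literature.Combinatorics.Optimization
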